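import Summits.BirchSwinnertonDyer.BirchSwinnertonDyer.Theorems.SylvesterTwoHeegnerIndexUpperDescentIndexTwo
import HarnessLib

/-!
# Route `SylvesterTwoHeegnerIndex` (rung K7t), crux `HeegnerIndexUpperAtTwoHSY` (item 19229), layer 2:
# the clean descent at `2` in terms of RATIONAL POINTS — `Ш(E/K) ↪ Ш(E_L/L)` for `[L̃ : K] = 2` as
# soon as `E(L̃)/E(K)` is torsion and `E(L̃)[2] = 0`

HONEST FRAMING (cell «bsd-cm», D-0074 seat `bsd-cm-k7t-c2`, item stmt-BirchSwinnertonDyer-19229; the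
crux — the Euler-system half of `BSD(E_p, 2)` on 𝒞_HSY — stays OPEN; nothing booked). Sequel of
`SylvesterTwoHeegnerIndexUpperDescentIndexTwo.lean` (p420915): there the injectivity of
`Ш(E/K) → Ш(E_L/L)` along a quadratic `L/K` was reduced to «every `Γ_{L̃}`-fixed geometric point on
which `Γ_K ∖ Γ_{L̃}` acts by `−1` is odd torsion». This file discharges that Galois-module hypothesis
from two statements about RATIONAL POINTS, with no twisting map: if every point of `E(L̃)` has a
positive multiple coming from `E(K)` (i.e. `rank E(L̃) = rank E(K)`, the twist has rank `0`) and
`E(L̃)[2] = 0`, then an anti-invariant `P = ι(Q)` satisfies `n•P ∈ E(K)`, hence `g₀•(n•P) = n•P = −n•P`,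
so `P` is torsion, and of ODD order because a point of order `2` among its multiples would come from
`E(L̃)[2]` (`shaRestriction_injective_of_torsion_quotient`). Galois descent `E(K̄)^{Γ_{L̃}} = E(L̃)` is
the tree's `mem_pointsOfGaloisClosure_of_forall_smul_eq`. For a Sylvester curve `E_p` and a Heegner field
`K′` both inputs hold (rank `E_p(K′) = 1 = rank E_p(ℚ)` since the twin has rank `0`; `E_p(K′)[2] = 0`),
so `ord₂ #Ш(E_p/ℚ) ≤ ord₂ #Ш(E_p/K′)`: the descent step of the Kolyvagin road costs NO power of `2` on
𝒞_HSY. (The instantiation at `E_p` — the two inputs as theorems over the field `K̃′ ⊆ ℚ̄` — is typing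
work left displayed; the SHARP Kolyvagin bound over `K′` at `2` remains the crux's open content.)
References: [SerreGaloisCohomology1997] I.§5.8; [SilvermanAEC2009] VIII.§1, X.§4; [Darmon2004] §3.9;
[GrossLMS1991] §2.
-/

set_option autoImplicit false
set_option linter.dupNamespace false

noncomputable section

open scoped Classical Pointwise

universe u

open Literature.NumberTheory.EllipticCurves WeierstrassCurve

namespace Summit.BirchSwinnertonDyer.BirchSwinnertonDyer.Theorems.SylvesterTwoUpper

variable {K : Type u} [Field K] [NumberField K] (W : WeierstrassCurve K)
variable (L : Type u) [Field L] [NumberField L] [Algebra K L]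

/-- **Clean descent at `2`, rational-points form.** Let `E/K` be an elliptic curve over a number
field, `L/K` finite with `[Γ_K : Γ_{L̃}] = 2` (`L̃ ⊆ K̄` the Galois closure). If every point of `E(L̃)`
has a positive multiple in the image of `E(K)` and `E(L̃)` has no point of order `2`, then
`Ш(E/K) → Ш(E_L/L)` is injective. Proof: by `shaRestriction_injective_of_index_two` it suffices that
every `Γ_{L̃}`-fixed anti-invariant geometric point `P` is odd torsion; Galois descent gives
`P = ι(Q)`, `Q ∈ E(L̃)`; with `n•Q ∈ E(K)` the point `n•P` is `Γ_K`-fixed and anti-invariant, so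
`2n•P = 0`; an even order would produce a point of order `2` in `ι(E(L̃))`.
[cite: SerreGaloisCohomology1997, I.§5.8] [cite: SilvermanAEC2009, VIII.§1 (proof of Prop. 1.2) and X.§4] -/
theorem shaRestriction_injective_of_torsion_quotient
    (h2 : (galSubgroupClosure (K := K) L).index = 2)
    (htor : ∀ Q : (W.baseChange (galoisClosureIn (K := K) L)).toAffine.Point,
      ∃ n : ℕ, 0 < n ∧ ∃ R : W.toAffine.Point,
        n • Q = Affine.Point.baseChange (W' := W) K (galoisClosureIn (K := K) L) R)
    (h2t : ∀ Q : (W.baseChange (galoisClosureIn (K := K) L)).toAffine.Point, 2 • Q = 0 → Q = 0) :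
    Function.Injective (shaRestriction W L) := by
  refine shaRestriction_injective_of_index_two W L h2 fun P hfix hanti => ?_
  -- notation: `ι : E(L̃) → E(K̄)` with values in the `Γ_K`-module of geometric points
  set N := galSubgroupClosure (K := K) L with hNdef
  let ι : (W.baseChange (galoisClosureIn (K := K) L)).toAffine.Point →+ geomPoints W :=
    Affine.Point.map (W' := W) ((galoisClosureIn (K := K) L).val)
  have hιinj : Function.Injective ι :=
    Affine.Point.map_injective (W' := W) _
  -- Galois descent: `P = ι Q`
  obtain ⟨Q, hQ⟩ := mem_pointsOfGaloisClosure_of_forall_smul_eq W L P hfix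
  have hQ' : ι Q = P := hQ
  subst hQ'
  -- an element outside `N`
  obtain ⟨g₀, hg₀⟩ : ∃ g₀ : Field.absoluteGaloisGroup K, g₀ ∉ N := by
    by_contra h
    push Not at h
    have htop : N = ⊤ := (Subgroup.eq_top_iff' N).mpr h
    rw [htop, Subgroup.index_top] at h2
    exact absurd h2 (by decide)
  -- a multiple of `Q` comes from `E(K)`, so it is `Γ_K`-fixed
  obtain ⟨n, hn, R, hR⟩ := htor Q
  have hnP : n • ι Q = ι (n • Q) := (map_nsmul ι n Q).symm
  have hfixR : g₀ • ι (n • Q) = ι (n • Q) := by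
    rw [hR]
    change Affine.Point.map ((show AlgebraicClosure K ≃ₐ[K] AlgebraicClosure K from g₀) :
        AlgebraicClosure K →ₐ[K] AlgebraicClosure K)
      (Affine.Point.map ((galoisClosureIn (K := K) L).val)
        (Affine.Point.baseChange (W' := W) K (galoisClosureIn (K := K) L) R)) =
      Affine.Point.map ((galoisClosureIn (K := K) L).val)
        (Affine.Point.baseChange (W' := W) K (galoisClosureIn (K := K) L) R)
    rw [Affine.Point.map_baseChange, Affine.Point.map_baseChange]
  -- hence `n • P = -(n • P)` and `2n • P = 0`
  have h1 : n • ι Q = -(n • ι Q) := by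
    have ha : g₀ • (n • ι Q) = -(n • ι Q) := by rw [smul_comm, hanti g₀ hg₀, smul_neg]
    rwa [hnP, hfixR, ← hnP] at ha
  have h2nP : (2 * n) • ι Q = 0 := by
    rw [two_mul, add_nsmul]
    nth_rewrite 1 [h1]
    exact neg_add_cancel (n • ι Q)
  -- the order of `P` is finite and ODD
  have hfin : IsOfFinAddOrder (ι Q) :=
    isOfFinAddOrder_iff_nsmul_eq_zero.mpr ⟨2 * n, by omega, h2nP⟩
  refine ⟨addOrderOf (ι Q), ?_, addOrderOf_nsmul_eq_zero (ι Q)⟩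
  rcases Nat.even_or_odd (addOrderOf (ι Q)) with ⟨k, hk⟩ | hodd
  · exfalso
    have hpos : 0 < addOrderOf (ι Q) := hfin.addOrderOf_pos
    have hk0 : k ≠ 0 := by rintro rfl; omega
    have hklt : k < addOrderOf (ι Q) := by omega
    have hkP : k • ι Q ≠ 0 := nsmul_ne_zero_of_lt_addOrderOf hk0 hklt
    -- `2 • (k • Q) = 0` in `E(L̃)`, so `k • Q = 0` (no `2`-torsion), so `k • ι Q = 0`
    have h2k : 2 • (k • ι Q) = 0 := by
      rw [two_nsmul, ← add_nsmul, ← hk]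
      exact addOrderOf_nsmul_eq_zero (ι Q)
    have h2kQ : 2 • (k • Q) = 0 := by
      apply hιinj
      rw [map_nsmul, map_nsmul, map_zero]
      exact h2k
    apply hkP
    rw [← map_nsmul, h2t _ h2kQ, map_zero]
  · exact hodd

end Summit.BirchSwinnertonDyer.BirchSwinnertonDyer.Theorems.SylvesterTwoUpper

end
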